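import Literature.Geometry.Lorentzian.BogovskiiVectorKernelCZ
import Literature.Geometry.Lorentzian.BogovskiiFrozenOperator
import Literature.Analysis.Calculus.DiagonalRestrictionL2
import HarnessLib

/-!
# The frozen, smoothly truncated first-derivative operator of `SV_η`: smoothness in the base point, `L²` bounds

(trunk G08 = T-LORENTZ; family `gr`; namespace `Literature.Geometry.Lorentzian.MaoOhTao`.)

Mao–Oh–Tao (arXiv:2308.13031), Lemma 2.3 (T3).  The vector analogue of `BogovskiiFrozenOperator` /
`BogovskiiDiagonalL2`: for the frozen CZ kernel `KV[η](t; w)` of `∂_k SV_η` (`BogovskiiVectorKernelCZ`) and the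
truncation `θ_ε = radialCutoff ε (2ε)`, the frozen truncated operator
`TV_ε[η](w, x) = ∫ (1 − θ_ε(t)) KV[η](t; w) g(x − t) dt` is `Cⁿ` in the base point `w` for `η ∈ C^{n+4}` with
`∂_{w_c}TV_ε[η] = TV_ε[∂_cη]` (`hasFDerivAt_frozenVOp`, `fderiv_frozenVOp_e`, `contDiff_frozenVOp`), jointly
measurable (`measurable_frozenVOp_uncurry`), bounded on `L²` uniformly in `ε` and `|w| ≤ W`
(`exists_frozenVOp_l2Const`, from `eLpNorm_truncate_convolution_le` with the primitive `z_aQ₂[η]` of degree `−2`), and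
its diagonal restriction satisfies `∫ |ζ(x)TV_ε[η](x, x)|² ≤ C∫|g|²` uniformly in `ε` (`exists_diagFrozenVOp_l2Const`,
by `exists_diag_lintegral_sq_le`).

## References

* Y. Mao, S.-J. Oh, T. Tao, arXiv:2308.13031 (2023), Lemma 2.3, pp. 8–9 (key `MaoOhTao2023`).
-/

noncomputable section

open scoped RealInnerProductSpace Topology Convolution ENNReal
open Filter MeasureTheory Set Metric Function
open Literature.Analysis.FluidPDE

namespace Literature.Geometry.Lorentzian

namespace MaoOhTao

section FrozenKernel

variable {φ : E3 → ℝ} {R ε : ℝ}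

/-- The smoothly truncated frozen vector kernel is continuous in `t` (`φ ∈ C²`). [folklore] -/
theorem continuous_truncKV (hφ : ContDiff ℝ 2 φ) (hR : ∀ z : E3, R < ‖z‖ → φ z = 0) (hε : 0 < ε) (a k : Fin 3)
    (w : E3) : Continuous fun t : E3 ↦ (1 - radialCutoff ε (2 * ε) t) * bogovskiiKV φ w a k t :=
  Literature.Analysis.SingularIntegrals.continuous_mul_of_eqOn_ball_zero
    (continuous_const.sub (radialCutoff_contDiff (n := 0) ε (2 * ε)).continuous) hε
    (fun t ht ↦ by rw [radialCutoff_eq_one hε.le (by linarith) ht.le, sub_self])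
    (continuousOn_bogovskiiKV hφ hR w a k)

/-- The truncated frozen vector kernel vanishes on `|t| ≤ ε`. [folklore] -/
theorem truncKV_eq_zero_of_le (φ : E3 → ℝ) (hε : 0 < ε) (a k : Fin 3) (w : E3) {t : E3} (ht : ‖t‖ ≤ ε) :
    (1 - radialCutoff ε (2 * ε) t) * bogovskiiKV φ w a k t = 0 := by
  rw [radialCutoff_eq_one hε.le (by linarith) ht, sub_self, zero_mul]

/-- **Base-point derivative of the truncated frozen vector kernel**: for every `t`,
`D_w[(1 − θ_ε(t)) KV[φ](t; w)] = Σ_c (1 − θ_ε(t)) KV[∂_cφ](t; w) · proj_c` (`φ ∈ C²`). [cite: MaoOhTao2023, Lemma 2.3] -/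
theorem hasFDerivAt_truncKV_base (hφ : ContDiff ℝ 2 φ) (hR : ∀ z : E3, R < ‖z‖ → φ z = 0) (hε : 0 < ε)
    (a k : Fin 3) (t w : E3) :
    HasFDerivAt (fun w ↦ (1 - radialCutoff ε (2 * ε) t) * bogovskiiKV φ w a k t)
      (∑ c, ((1 - radialCutoff ε (2 * ε) t) * bogovskiiKV (pd c φ) w a k t) •
        (EuclideanSpace.proj c : E3 →L[ℝ] ℝ)) w := by
  by_cases ht : ‖t‖ ≤ ε
  · have h0 : (1 : ℝ) - radialCutoff ε (2 * ε) t = 0 := by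
      rw [radialCutoff_eq_one hε.le (by linarith) ht, sub_self]
    simp only [h0, zero_mul, zero_smul, Finset.sum_const_zero]
    exact hasFDerivAt_const 0 w
  · have ht0 : t ≠ 0 := by
      intro h; rw [h, norm_zero] at ht; exact ht hε.le
    obtain ⟨hd, hdir⟩ := hasFDerivAt_bogovskiiKV_base hφ hR a k ht0 w
    have h1 : HasFDerivAt (fun w ↦ bogovskiiKV φ w a k t)
        (∑ c, bogovskiiKV (pd c φ) w a k t • (EuclideanSpace.proj c : E3 →L[ℝ] ℝ)) w := by
      have := hd.hasFDerivAt
      rw [fderiv_eq_sum_pd] at this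
      simp only [pd] at this hdir
      simpa only [hdir] using this
    have h2 := h1.const_mul (1 - radialCutoff ε (2 * ε) t)
    rw [Finset.smul_sum] at h2
    simpa only [smul_smul, smul_eq_mul] using h2

/-- Size of the truncated frozen vector kernels with `η` replaced by a first partial, uniformly on `|w| ≤ ρ`:
`|(1 − θ_ε) KV[∂_cφ](t; w)| ≤ M(2D³ + 2D⁴) ε⁻³`. [folklore] -/
theorem abs_truncKV_pd_le (hφ : ContDiff ℝ 2 φ) (hR : ∀ z : E3, R < ‖z‖ → φ z = 0) {M : ℝ}
    (hM1 : ∀ a w, |pd a φ w| ≤ M) (hM2 : ∀ a b w, |pd a (pd b φ) w| ≤ M)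
    (hε : 0 < ε) {ρ : ℝ} {w : E3} (hw : ‖w‖ ≤ ρ) (a k c : Fin 3) (t : E3) :
    |(1 - radialCutoff ε (2 * ε) t) * bogovskiiKV (pd c φ) w a k t| ≤
      M * (2 * (max (R + ρ) 0) ^ 3 + 2 * (max (R + ρ) 0) ^ 4) / ε ^ 3 := by
  have hMnn : 0 ≤ M := (abs_nonneg _).trans (hM1 0 0)
  have hD0 : 0 ≤ max (R + ρ) 0 := le_max_right _ _
  by_cases ht : ‖t‖ ≤ ε
  · rw [truncKV_eq_zero_of_le _ hε a k w ht, abs_zero]; positivity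
  · have htε : ε < ‖t‖ := not_le.1 ht
    have ht0 : t ≠ 0 := norm_pos_iff.1 (hε.trans htε)
    obtain ⟨hcφ, hRc⟩ := contDiff_pd_and_vanish (n := 1) hφ hR c
    rw [abs_mul]
    calc _ ≤ 1 * (M * (2 * (max (R + ρ) 0) ^ 3 + 2 * (max (R + ρ) 0) ^ 4) / ‖t‖ ^ 3) :=
          mul_le_mul (Literature.Analysis.SingularIntegrals.abs_one_sub_radialCutoff_le ε t)
            (abs_bogovskiiKV_le hcφ hRc (hM1 c) (fun b w ↦ hM2 b c w) hw a k ht0) (abs_nonneg _) zero_le_one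
      _ ≤ _ := by
          rw [one_mul]
          gcongr

/-- Norm of the base-point derivative of the truncated frozen vector kernel, uniformly on `|w| ≤ ρ`. [folklore] -/
theorem norm_truncKV_base_deriv_le (hφ : ContDiff ℝ 2 φ) (hR : ∀ z : E3, R < ‖z‖ → φ z = 0) {M : ℝ}
    (hM1 : ∀ a w, |pd a φ w| ≤ M) (hM2 : ∀ a b w, |pd a (pd b φ) w| ≤ M)
    (hε : 0 < ε) {ρ : ℝ} {w : E3} (hw : ‖w‖ ≤ ρ) (a k : Fin 3) (t : E3) :
    ‖∑ c, ((1 - radialCutoff ε (2 * ε) t) * bogovskiiKV (pd c φ) w a k t) • (EuclideanSpace.proj c : E3 →L[ℝ] ℝ)‖ ≤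
      3 * (M * (2 * (max (R + ρ) 0) ^ 3 + 2 * (max (R + ρ) 0) ^ 4) / ε ^ 3) := by
  calc _ ≤ ∑ c, ‖((1 - radialCutoff ε (2 * ε) t) * bogovskiiKV (pd c φ) w a k t) •
        (EuclideanSpace.proj c : E3 →L[ℝ] ℝ)‖ := norm_sum_le _ _
    _ ≤ ∑ _c : Fin 3, M * (2 * (max (R + ρ) 0) ^ 3 + 2 * (max (R + ρ) 0) ^ 4) / ε ^ 3 := by
        refine Finset.sum_le_sum fun c _ ↦ ?_
        rw [norm_smul, Real.norm_eq_abs]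
        calc _ ≤ |(1 - radialCutoff ε (2 * ε) t) * bogovskiiKV (pd c φ) w a k t| * 1 := by
              gcongr
              refine ContinuousLinearMap.opNorm_le_bound _ zero_le_one fun v ↦ ?_
              rw [one_mul]
              simpa using PiLp.norm_apply_le v c
          _ ≤ _ := by rw [mul_one]; exact abs_truncKV_pd_le hφ hR hM1 hM2 hε hw a k c t
    _ = _ := by simp [Finset.sum_const, Finset.card_univ, Fintype.card_fin]

end FrozenKernel

section FrozenOperator

variable {φ : E3 → ℝ} {R ε : ℝ} {g : E3 → ℝ}

/-- **The frozen truncated vector operator is differentiable in the base point, derivative under the integral**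
(`φ ∈ C³`, `g` continuous with compact support). [cite: MaoOhTao2023, Lemma 2.3 (T3)] -/
theorem hasFDerivAt_frozenVOp (hφ : ContDiff ℝ 3 φ) (hR : ∀ z : E3, R < ‖z‖ → φ z = 0) (hε : 0 < ε)
    (hg : Continuous g) (hgc : HasCompactSupport g) (a k : Fin 3) (x w₀ : E3) :
    HasFDerivAt (fun w ↦ ∫ t, (1 - radialCutoff ε (2 * ε) t) * bogovskiiKV φ w a k t * g (x - t))
      (∫ t, g (x - t) • ∑ c, ((1 - radialCutoff ε (2 * ε) t) * bogovskiiKV (pd c φ) w₀ a k t) •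
        (EuclideanSpace.proj c : E3 →L[ℝ] ℝ)) w₀ := by
  have h2 : ContDiff ℝ 2 φ := hφ.of_le (by norm_cast)
  obtain ⟨M, -, hM1, hM2, -⟩ := exists_bound_pd_le_three hφ hR
  have hk : ∀ w, Continuous fun t : E3 ↦ (1 - radialCutoff ε (2 * ε) t) * bogovskiiKV φ w a k t :=
    fun w ↦ continuous_truncKV h2 hR hε a k w
  have hk' : ∀ w, Continuous fun t : E3 ↦ ∑ c, ((1 - radialCutoff ε (2 * ε) t) * bogovskiiKV (pd c φ) w a k t) •
      (EuclideanSpace.proj c : E3 →L[ℝ] ℝ) := by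
    intro w
    refine continuous_finsetSum _ fun c _ ↦ ?_
    obtain ⟨hcφ, hRc⟩ := contDiff_pd_and_vanish (n := 2) hφ hR c
    exact (continuous_truncKV hcφ hRc hε a k w).smul continuous_const
  exact hasFDerivAt_integral_kernel_mul_shift hk hk' (fun w t ↦ hasFDerivAt_truncKV_base h2 hR hε a k t w)
    (B := 3 * (M * (2 * (max (R + (‖w₀‖ + 1)) 0) ^ 3 + 2 * (max (R + (‖w₀‖ + 1)) 0) ^ 4) / ε ^ 3))
    (fun w hw t ↦ norm_truncKV_base_deriv_le h2 hR hM1 hM2 hε (ρ := ‖w₀‖ + 1)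
      (by rw [mem_ball, dist_eq_norm] at hw; have := norm_sub_norm_le w w₀; linarith) a k t) hg hgc x

/-- **Directional base-point derivatives fall on `η`** (vector case). [cite: MaoOhTao2023, Lemma 2.3 (T3)] -/
theorem fderiv_frozenVOp_e (hφ : ContDiff ℝ 3 φ) (hR : ∀ z : E3, R < ‖z‖ → φ z = 0) (hε : 0 < ε)
    (hg : Continuous g) (hgc : HasCompactSupport g) (a k : Fin 3) (x w : E3) (c : Fin 3) :
    fderiv ℝ (fun w ↦ ∫ t, (1 - radialCutoff ε (2 * ε) t) * bogovskiiKV φ w a k t * g (x - t)) w (e c) =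
      ∫ t, (1 - radialCutoff ε (2 * ε) t) * bogovskiiKV (pd c φ) w a k t * g (x - t) := by
  have h2 : ContDiff ℝ 2 φ := hφ.of_le (by norm_cast)
  obtain ⟨M, -, hM1, hM2, -⟩ := exists_bound_pd_le_three hφ hR
  have hk : ∀ w, Continuous fun t : E3 ↦ (1 - radialCutoff ε (2 * ε) t) * bogovskiiKV φ w a k t :=
    fun w ↦ continuous_truncKV h2 hR hε a k w
  have hk' : ∀ w, Continuous fun t : E3 ↦ ∑ c, ((1 - radialCutoff ε (2 * ε) t) * bogovskiiKV (pd c φ) w a k t) •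
      (EuclideanSpace.proj c : E3 →L[ℝ] ℝ) := by
    intro w
    refine continuous_finsetSum _ fun c _ ↦ ?_
    obtain ⟨hcφ, hRc⟩ := contDiff_pd_and_vanish (n := 2) hφ hR c
    exact (continuous_truncKV hcφ hRc hε a k w).smul continuous_const
  rw [fderiv_integral_kernel_mul_shift_apply hk hk' (fun w t ↦ hasFDerivAt_truncKV_base h2 hR hε a k t w)
    (B := 3 * (M * (2 * (max (R + (‖w‖ + 1)) 0) ^ 3 + 2 * (max (R + (‖w‖ + 1)) 0) ^ 4) / ε ^ 3))
    (fun w' hw t ↦ norm_truncKV_base_deriv_le h2 hR hM1 hM2 hε (ρ := ‖w‖ + 1)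
      (by rw [mem_ball, dist_eq_norm] at hw; have := norm_sub_norm_le w' w; linarith) a k t) hg hgc x (e c)]
  refine integral_congr_ae (ae_of_all _ fun t ↦ ?_)
  simp only [FunLike.coe_sum, Finset.sum_apply, FunLike.coe_smul, Pi.smul_apply, smul_eq_mul]
  simp [e, Finset.sum_ite_eq']

/-- **The frozen truncated vector operator is `Cⁿ` in the base point** when `η ∈ C^{n+3}`.
[cite: MaoOhTao2023, Lemma 2.3 (T3)] -/
theorem contDiff_frozenVOp (hε : 0 < ε) (hg : Continuous g) (hgc : HasCompactSupport g) (a k : Fin 3) :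
    ∀ (n : ℕ) (φ : E3 → ℝ), ContDiff ℝ ((n + 3 : ℕ) : WithTop ℕ∞) φ → (∀ z : E3, R < ‖z‖ → φ z = 0) → ∀ x : E3,
      ContDiff ℝ n fun w ↦ ∫ t, (1 - radialCutoff ε (2 * ε) t) * bogovskiiKV φ w a k t * g (x - t)
  | 0, φ, hφ, hR, x => by
    have h3 : ContDiff ℝ 3 φ := hφ.of_le (by norm_cast)
    exact contDiff_zero.2 (continuous_iff_continuousAt.2 fun w ↦
      (hasFDerivAt_frozenVOp h3 hR hε hg hgc a k x w).continuousAt)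
  | n + 1, φ, hφ, hR, x => by
    have h3 : ContDiff ℝ 3 φ := hφ.of_le (by norm_cast; omega)
    have hφ' : ContDiff ℝ (((n + 3 : ℕ) : WithTop ℕ∞) + 1) φ := by
      have : (((n + 3 : ℕ) : WithTop ℕ∞) + 1) = ((n + 1 + 3 : ℕ) : WithTop ℕ∞) := by push_cast; ring
      rw [this]; exact hφ
    have hsucc : ((n + 1 : ℕ) : WithTop ℕ∞) = (n : WithTop ℕ∞) + 1 := by push_cast; rfl
    rw [hsucc, contDiff_succ_iff_hasFDerivAt]
    refine ⟨fun w ↦ ∑ c, (∫ t, (1 - radialCutoff ε (2 * ε) t) * bogovskiiKV (pd c φ) w a k t * g (x - t)) •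
      (EuclideanSpace.proj c : E3 →L[ℝ] ℝ), ?_, fun w ↦ ?_⟩
    · refine ContDiff.sum fun c _ ↦ ?_
      have hc : ContDiff ℝ ((n + 3 : ℕ) : WithTop ℕ∞) (pd c φ) := contDiff_pd hφ' c
      have hRc : ∀ z : E3, R < ‖z‖ → pd c φ z = 0 := fun z hz ↦ pd_eq_zero_of_norm_lt hR c z hz
      exact (contDiff_frozenVOp hε hg hgc a k n (pd c φ) hc hRc x).smul contDiff_const
    · have hd := (hasFDerivAt_frozenVOp h3 hR hε hg hgc a k x w).differentiableAt.hasFDerivAt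
      have heq : fderiv ℝ (fun w ↦ ∫ t, (1 - radialCutoff ε (2 * ε) t) * bogovskiiKV φ w a k t * g (x - t)) w =
          ∑ c, (∫ t, (1 - radialCutoff ε (2 * ε) t) * bogovskiiKV (pd c φ) w a k t * g (x - t)) •
            (EuclideanSpace.proj c : E3 →L[ℝ] ℝ) := by
        rw [fderiv_eq_sum_pd]
        refine Finset.sum_congr rfl fun c _ ↦ ?_
        rw [pd, fderiv_frozenVOp_e h3 hR hε hg hgc a k x w c]
      rwa [heq] at hd

/-- Differentiability of the frozen truncated vector operator in the base point. [folklore] -/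
theorem differentiable_frozenVOp {φ : E3 → ℝ} (hφ : ContDiff ℝ 3 φ) (hR : ∀ z : E3, R < ‖z‖ → φ z = 0) (hε : 0 < ε)
    (hg : Continuous g) (hgc : HasCompactSupport g) (a k : Fin 3) (x : E3) :
    Differentiable ℝ fun w ↦ ∫ t, (1 - radialCutoff ε (2 * ε) t) * bogovskiiKV φ w a k t * g (x - t) :=
  fun w ↦ (hasFDerivAt_frozenVOp hφ hR hε hg hgc a k x w).differentiableAt

/-- **Joint measurability** of the frozen truncated vector operator in `(w, x)`. [folklore] -/
theorem measurable_frozenVOp_uncurry {φ : E3 → ℝ} (hφ : ContDiff ℝ 1 φ) (ε : ℝ) (hg : Continuous g) (a k : Fin 3) :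
    Measurable fun p : E3 × E3 ↦
      ∫ t, (1 - radialCutoff ε (2 * ε) t) * bogovskiiKV φ p.1 a k t * g (p.2 - t) := by
  have hθ : Measurable fun t : E3 ↦ 1 - radialCutoff ε (2 * ε) t :=
    (continuous_const.sub (radialCutoff_contDiff (n := 0) ε (2 * ε)).continuous).measurable
  have hK := measurable_bogovskiiKV_uncurry hφ a k
  have m1 : Measurable fun q : (E3 × E3) × E3 ↦ 1 - radialCutoff ε (2 * ε) q.2 := hθ.comp measurable_snd
  have mi : Measurable fun q : (E3 × E3) × E3 ↦ (q.2, q.1.1) :=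
    measurable_snd.prodMk (measurable_fst.comp measurable_fst)
  have m2 : Measurable fun q : (E3 × E3) × E3 ↦ bogovskiiKV φ q.1.1 a k q.2 := (hK.comp mi :)
  have m3 : Measurable fun q : (E3 × E3) × E3 ↦ g (q.1.2 - q.2) :=
    hg.measurable.comp ((measurable_snd.comp measurable_fst).sub measurable_snd)
  have hF : Measurable fun q : (E3 × E3) × E3 ↦
      (1 - radialCutoff ε (2 * ε) q.2) * bogovskiiKV φ q.1.1 a k q.2 * g (q.1.2 - q.2) := (m1.mul m2).mul m3
  have hS : StronglyMeasurable (uncurry fun (p : E3 × E3) (t : E3) ↦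
      (1 - radialCutoff ε (2 * ε) t) * bogovskiiKV φ p.1 a k t * g (p.2 - t)) := (hF.stronglyMeasurable :)
  exact ((hS.integral_prod_right (ν := (volume : Measure E3))).measurable :)

end FrozenOperator

section FrozenOperatorL2

variable {φ : E3 → ℝ} {R : ℝ}

/-- **Uniform `L²` bound for the frozen truncated vector operators** (Calderón–Zygmund, via
`eLpNorm_truncate_convolution_le`, primitive `z_aQ₂[φ]` of degree `−2`): for `φ ∈ C³` vanishing off `B̄_R` and `W`
there is `C < ∞` with `∫ |∫ (1 − θ_ε(t)) KV[φ](t; w) g(x − t) dt|² dx ≤ C ∫ |g|²` for all `ε > 0`, `|w| ≤ W` and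
continuous compactly supported `g`. [cite: MaoOhTao2023, Lemma 2.3 (T3)] -/
theorem exists_frozenVOp_l2Const (hφ : ContDiff ℝ 3 φ) (hR : ∀ z : E3, R < ‖z‖ → φ z = 0) (a k : Fin 3) (W : ℝ) :
    ∃ C : ℝ≥0∞, C < ⊤ ∧ ∀ ε : ℝ, 0 < ε → ∀ w : E3, ‖w‖ ≤ W → ∀ g : E3 → ℝ, Continuous g → HasCompactSupport g →
      ∫⁻ x, ‖∫ t, (1 - radialCutoff ε (2 * ε) t) * bogovskiiKV φ w a k t * g (x - t)‖ₑ ^ (2 : ℝ) ≤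
        C * ∫⁻ x, ‖g x‖ₑ ^ (2 : ℝ) := by
  have h1 : ContDiff ℝ 1 φ := hφ.of_le (by norm_cast)
  have h2 : ContDiff ℝ 2 φ := hφ.of_le (by norm_cast)
  obtain ⟨M, hM0, hM1, hM2, -⟩ := exists_bound_pd_le_three hφ hR
  have hMnn : 0 ≤ M := (abs_nonneg _).trans (hM0 0)
  obtain ⟨B, hB0, hB⟩ := exists_norm_fderiv_radialCutoff_le
  obtain ⟨Cs, hC0, hC⟩ := Literature.Analysis.SingularIntegrals.exists_norm_deriv_smoothTransition_le
  set D : ℝ := max (R + W) 0 with hD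
  have hD0 : 0 ≤ D := le_max_right _ _
  set A₀ : ℝ := M * (2 * D ^ 3 + 2 * D ^ 4) with hA₀
  set A₁ : ℝ := 3 * (M * (4 * D ^ 4 + 2 * D ^ 5)) with hA₁
  set A : ℝ := A₀ + A₁ with hA
  set A' : ℝ := 2 * M * D ^ 3 with hA'
  have hA₀0 : 0 ≤ A₀ := by positivity
  have hA₁0 : 0 ≤ A₁ := by positivity
  set V : ℝ := (volume : Measure E3).real (ball 0 1) with hV
  set Atot : ℝ := 15 * (8 * A * V + 24 * A * (1 + 2 * B) * V + ‖e k‖ * (A' * V * (38 * Cs + 7 * B))) with hAtot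
  refine ⟨ENNReal.ofReal Atot ^ (2 : ℝ), ENNReal.rpow_lt_top_of_nonneg (by norm_num) ENNReal.ofReal_ne_top, ?_⟩
  intro ε hε w hw g hg hgc
  have hρ : ‖w‖ ≤ W := hw
  have hK : ContDiffOn ℝ 1 (bogovskiiKV φ w a k) {0}ᶜ := contDiffOn_bogovskiiKV hφ hR w a k
  have hK0 : ∀ z : E3, z ≠ 0 → |bogovskiiKV φ w a k z| ≤ A * (‖z‖ ^ 3)⁻¹ := by
    intro z hz
    have hn : 0 < ‖z‖ := norm_pos_iff.2 hz
    calc _ ≤ A₀ / ‖z‖ ^ 3 := abs_bogovskiiKV_le h1 hR hM0 hM1 hρ a k hz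
      _ ≤ A / ‖z‖ ^ 3 := by gcongr; linarith
      _ = A * (‖z‖ ^ 3)⁻¹ := div_eq_mul_inv _ _
  have hK1 : ∀ z : E3, z ≠ 0 → ‖fderiv ℝ (bogovskiiKV φ w a k) z‖ ≤ A * (‖z‖ ^ 4)⁻¹ := by
    intro z hz
    have hn : 0 < ‖z‖ := norm_pos_iff.2 hz
    calc _ ≤ 3 * (M * (4 * D ^ 4 + 2 * D ^ 5) / ‖z‖ ^ 4) := norm_fderiv_bogovskiiKV_le h2 hR hM1 hM2 hρ a k hz
      _ = A₁ / ‖z‖ ^ 4 := by rw [hA₁]; ring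
      _ ≤ A / ‖z‖ ^ 4 := by gcongr; linarith
      _ = A * (‖z‖ ^ 4)⁻¹ := div_eq_mul_inv _ _
  have hG : ∀ z : E3, z ≠ 0 → DifferentiableAt ℝ (fun z : E3 ↦ z a * bogovskiiQ φ w 2 z) z :=
    fun z hz ↦ (differentiableAt_vectorKernel h1 hR w a hz).1
  have hKG : ∀ z : E3, z ≠ 0 → bogovskiiKV φ w a k z = fderiv ℝ (fun z : E3 ↦ z a * bogovskiiQ φ w 2 z) z (e k) :=
    fun z hz ↦ ((differentiableAt_vectorKernel h1 hR w a hz).2 k).symm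
  have hG2 : ∀ z : E3, z ≠ 0 → |z a * bogovskiiQ φ w 2 z| ≤ A' * (‖z‖ ^ 2)⁻¹ := by
    intro z hz
    rw [← div_eq_mul_inv]
    exact abs_vectorKernel_le hφ.continuous hR hM0 hρ a z
  have hgC : Continuous fun y ↦ (g y : ℂ) := Complex.continuous_ofReal.comp hg
  have hgCc : HasCompactSupport fun y ↦ (g y : ℂ) := hgc.comp_left Complex.ofReal_zero
  have hf : Integrable fun y ↦ (g y : ℂ) := hgC.integrable_of_hasCompactSupport hgCc
  have hf2 : MemLp (fun y ↦ (g y : ℂ)) 2 volume := hgC.memLp_of_hasCompactSupport hgCc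
  have hε' : (0 : ℝ) < ε / 2 := by positivity
  have hN : ε / 2 < D + ε + 1 := by linarith
  have hL2 := Literature.Analysis.SingularIntegrals.eLpNorm_truncate_convolution_le hK hK0 hK1 hG hKG hG2 hB0 hB
    hC0 hC hε hε' hN hf hf2
  have hvan : ∀ t, t ∉ ball (0 : E3) (D + ε + 1) \ closedBall 0 (ε / 2) →
      (1 - radialCutoff ε (2 * ε) t) * bogovskiiKV φ w a k t = 0 := by
    intro t ht
    rw [Set.mem_sdiff, not_and_or, not_not, mem_ball, dist_zero_right, not_lt, mem_closedBall, dist_zero_right] at ht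
    rcases ht with ht | ht
    · have : max (R + ‖w‖) 0 < ‖t‖ := by
        calc max (R + ‖w‖) 0 ≤ D := max_le_max (by linarith) le_rfl
          _ < ‖t‖ := by linarith
      rw [bogovskiiKV_eq_zero_of_lt hR w a k this, mul_zero]
    · exact Literature.Analysis.SingularIntegrals.truncate_eq_zero _ hε (by linarith)
  have hconv : ∀ x, ((ball (0 : E3) (D + ε + 1) \ closedBall 0 (ε / 2)).indicator
      (fun z : E3 ↦ (1 - radialCutoff ε (2 * ε) z) * bogovskiiKV φ w a k z) ⋆[ContinuousLinearMap.lsmul ℝ ℝ, volume]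
        fun y ↦ (g y : ℂ)) x =
      ((∫ t, (1 - radialCutoff ε (2 * ε) t) * bogovskiiKV φ w a k t * g (x - t) : ℝ) : ℂ) :=
    fun x ↦ convolution_indicator_ofReal_eq hvan x
  have hlhs : ∫⁻ x, ‖∫ t, (1 - radialCutoff ε (2 * ε) t) * bogovskiiKV φ w a k t * g (x - t)‖ₑ ^ (2 : ℝ) =
      eLpNorm (((ball (0 : E3) (D + ε + 1) \ closedBall 0 (ε / 2)).indicator
        (fun z : E3 ↦ (1 - radialCutoff ε (2 * ε) z) * bogovskiiKV φ w a k z) ⋆[ContinuousLinearMap.lsmul ℝ ℝ, volume]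
        fun y ↦ (g y : ℂ))) 2 volume ^ (2 : ℝ) := by
    rw [← lintegral_enorm_sq_eq_eLpNorm_sq]
    refine lintegral_congr fun x ↦ ?_
    rw [hconv x, enorm_eq_nnnorm, enorm_eq_nnnorm, Complex.nnnorm_real]
  have hrhs : ∫⁻ x, ‖g x‖ₑ ^ (2 : ℝ) = eLpNorm (fun y ↦ (g y : ℂ)) 2 volume ^ (2 : ℝ) := by
    rw [← lintegral_enorm_sq_eq_eLpNorm_sq]
    refine lintegral_congr fun x ↦ ?_
    rw [enorm_eq_nnnorm, enorm_eq_nnnorm, Complex.nnnorm_real]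
  rw [hlhs, hrhs, ← ENNReal.mul_rpow_of_nonneg _ _ (by norm_num)]
  exact ENNReal.rpow_le_rpow hL2 (by norm_num)

end FrozenOperatorL2

section Diag

variable {η : E3 → ℝ} {R : ℝ}

/-- Iterated partials of `η ∈ C⁶` vanishing off `B̄_R` are `C³` and vanish off `B̄_R`. [folklore] -/
theorem contDiff_three_pd_iter (hη : ContDiff ℝ 6 η) (hR : ∀ z : E3, R < ‖z‖ → η z = 0) (a b c : Fin 3) :
    (ContDiff ℝ 3 η ∧ ∀ z : E3, R < ‖z‖ → η z = 0) ∧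
    (ContDiff ℝ 3 (pd a η) ∧ ∀ z : E3, R < ‖z‖ → pd a η z = 0) ∧
    (ContDiff ℝ 3 (pd b (pd a η)) ∧ ∀ z : E3, R < ‖z‖ → pd b (pd a η) z = 0) ∧
    (ContDiff ℝ 3 (pd c (pd b (pd a η))) ∧ ∀ z : E3, R < ‖z‖ → pd c (pd b (pd a η)) z = 0) := by
  obtain ⟨ha, hRa⟩ := contDiff_pd_and_vanish (n := 5) hη hR a
  obtain ⟨hb, hRb⟩ := contDiff_pd_and_vanish (n := 4) ha hRa b
  obtain ⟨hc, hRc⟩ := contDiff_pd_and_vanish (n := 3) hb hRb c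
  exact ⟨⟨hη.of_le (by norm_cast), hR⟩, ⟨ha.of_le (by norm_cast), hRa⟩, ⟨hb.of_le (by norm_cast), hRb⟩, ⟨hc, hRc⟩⟩

/-- **`L²` bound of the diagonal restriction of the frozen truncated vector operator** (the variable-coefficient CZ
term of `∂_k SV_η`): for `η ∈ C⁶` vanishing off `B̄_R` and a measurable weight `|ζ| ≤ 1` vanishing for `|x| > D`,
there is `C < ∞` with `∫ |ζ(x) TV_ε[η](x, x)|² dx ≤ C ∫|g|²` for all `ε > 0` and all continuous compactly supported
`g`. [cite: MaoOhTao2023, Lemma 2.3 (T3)] -/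
theorem exists_diagFrozenVOp_l2Const (hη : ContDiff ℝ 6 η) (hR : ∀ z : E3, R < ‖z‖ → η z = 0) (a k : Fin 3)
    {ζ : E3 → ℝ} (hζm : Measurable ζ) (hζ1 : ∀ x, |ζ x| ≤ 1) {D : ℝ} (hζD : ∀ x : E3, D < ‖x‖ → ζ x = 0) :
    ∃ C : ℝ≥0∞, C < ⊤ ∧ ∀ ε : ℝ, 0 < ε → ∀ g : E3 → ℝ, Continuous g → HasCompactSupport g →
      ∫⁻ x, ‖ζ x * ∫ t, (1 - radialCutoff ε (2 * ε) t) * bogovskiiKV η x a k t * g (x - t)‖ₑ ^ (2 : ℝ) ≤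
        C * ∫⁻ x, ‖g x‖ₑ ^ (2 : ℝ) := by
  obtain ⟨Cd, hCd, hdiag⟩ := Literature.Analysis.Calculus.exists_diag_lintegral_sq_le
  obtain ⟨⟨h3, -⟩, ⟨h0, hR0⟩, ⟨h10, hR10⟩, ⟨h210, hR210⟩⟩ := contDiff_three_pd_iter hη hR 0 1 2
  obtain ⟨-, ⟨h1, hR1⟩, ⟨h21, hR21⟩, -⟩ := contDiff_three_pd_iter hη hR 1 2 0
  obtain ⟨-, ⟨h2, hR2⟩, -, -⟩ := contDiff_three_pd_iter hη hR 2 0 0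
  obtain ⟨-, -, ⟨h20, hR20⟩, -⟩ := contDiff_three_pd_iter hη hR 0 2 0
  obtain ⟨C₀, hC₀, hL₀⟩ := exists_frozenVOp_l2Const h3 hR a k (D + 1)
  obtain ⟨Ct, hCt, hLt⟩ := exists_frozenVOp_l2Const h0 hR0 a k (D + 1)
  obtain ⟨Cv, hCv, hLv⟩ := exists_frozenVOp_l2Const h1 hR1 a k (D + 1)
  obtain ⟨Cu, hCu, hLu⟩ := exists_frozenVOp_l2Const h2 hR2 a k (D + 1)
  obtain ⟨Cvt, hCvt, hLvt⟩ := exists_frozenVOp_l2Const h10 hR10 a k (D + 1)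
  obtain ⟨Cut, hCut, hLut⟩ := exists_frozenVOp_l2Const h20 hR20 a k (D + 1)
  obtain ⟨Cuv, hCuv, hLuv⟩ := exists_frozenVOp_l2Const h21 hR21 a k (D + 1)
  obtain ⟨Cuvt, hCuvt, hLuvt⟩ := exists_frozenVOp_l2Const h210 hR210 a k (D + 1)
  set Vol : ℝ≥0∞ := volume (closedBall (0 : E3) (D + 1)) with hVol
  have hVoltop : Vol < ⊤ := measure_closedBall_lt_top
  set Cs : ℝ≥0∞ := C₀ + Ct + Cv + Cu + Cvt + Cut + Cuv + Cuvt with hCs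
  have hCstop : Cs < ⊤ := by
    simp only [hCs, ENNReal.add_lt_top]
    exact ⟨⟨⟨⟨⟨⟨⟨hC₀, hCt⟩, hCv⟩, hCu⟩, hCvt⟩, hCut⟩, hCuv⟩, hCuvt⟩
  refine ⟨Cd * (8 * (Vol * Cs)), ENNReal.mul_lt_top hCd (ENNReal.mul_lt_top (by norm_num)
    (ENNReal.mul_lt_top hVoltop hCstop)), ?_⟩
  intro ε hε g hg hgc
  set T : (E3 → ℝ) → E3 → E3 → ℝ := fun ψ w x ↦
    ζ x * ∫ t, (1 - radialCutoff ε (2 * ε) t) * bogovskiiKV ψ w a k t * g (x - t) with hT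
  have hC3 : ∀ x, ContDiff ℝ 3 fun w ↦ T η w x := fun x ↦
    contDiff_const.mul (contDiff_frozenVOp hε hg hgc a k 3 η hη hR x)
  have hder : ∀ (ψ : E3 → ℝ), ContDiff ℝ 3 ψ → (∀ z : E3, R < ‖z‖ → ψ z = 0) → ∀ (c : Fin 3) (w x : E3),
      fderiv ℝ (fun w ↦ T ψ w x) w (EuclideanSpace.single c 1) = T (pd c ψ) w x := by
    intro ψ hψ hRψ c w x
    simp only [hT]
    rw [fderiv_const_mul ((differentiable_frozenVOp hψ hRψ hε hg hgc a k x) w)]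
    simp only [FunLike.coe_smul, Pi.smul_apply, smul_eq_mul]
    rw [show (EuclideanSpace.single c (1 : ℝ) : E3) = e c from rfl, fderiv_frozenVOp_e hψ hRψ hε hg hgc a k x w c]
  have hmeas : ∀ (ψ : E3 → ℝ), ContDiff ℝ 3 ψ → Measurable (uncurry (T ψ)) := by
    intro ψ hψ
    have h := measurable_frozenVOp_uncurry (hψ.of_le (by norm_cast)) ε hg a k (g := g)
    exact (hζm.comp measurable_snd).mul h
  have hsupp : ∀ (ψ : E3 → ℝ) (w x : E3), D < ‖x‖ → T ψ w x = 0 := by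
    intro ψ w x hx
    simp only [hT, hζD x hx, zero_mul]
  have hmain := hdiag D (T η) (T (pd 0 η)) (T (pd 1 η)) (T (pd 2 η)) (T (pd 1 (pd 0 η))) (T (pd 2 (pd 0 η)))
    (T (pd 2 (pd 1 η))) (T (pd 2 (pd 1 (pd 0 η)))) hC3
    (hder η h3 hR 0) (hder η h3 hR 1) (hder η h3 hR 2) (hder _ h0 hR0 1) (hder _ h0 hR0 2) (hder _ h1 hR1 2)
    (hder _ h10 hR10 2) (hmeas η h3) (hmeas _ h0) (hmeas _ h1) (hmeas _ h2) (hmeas _ h10) (hmeas _ h20)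
    (hmeas _ h21) (hmeas _ h210)
    (fun w x hx ↦ ⟨hsupp _ w x hx, hsupp _ w x hx, hsupp _ w x hx, hsupp _ w x hx, hsupp _ w x hx, hsupp _ w x hx,
      hsupp _ w x hx, hsupp _ w x hx⟩)
  set G : ℝ≥0∞ := ∫⁻ x, ‖g x‖ₑ ^ (2 : ℝ) with hG
  have hterm : ∀ (ψ : E3 → ℝ) (Cψ : ℝ≥0∞), Cψ ≤ Cs →
      (∀ ε : ℝ, 0 < ε → ∀ w : E3, ‖w‖ ≤ D + 1 → ∀ g : E3 → ℝ, Continuous g → HasCompactSupport g →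
        ∫⁻ x, ‖∫ t, (1 - radialCutoff ε (2 * ε) t) * bogovskiiKV ψ w a k t * g (x - t)‖ₑ ^ (2 : ℝ) ≤
          Cψ * ∫⁻ x, ‖g x‖ₑ ^ (2 : ℝ)) →
      ∫⁻ w in closedBall (0 : E3) (D + 1), ∫⁻ x, ‖T ψ w x‖ₑ ^ (2 : ℝ) ≤ Vol * Cs * G := by
    intro ψ Cψ hCψ hL
    have hin : ∀ w ∈ closedBall (0 : E3) (D + 1), ∫⁻ x, ‖T ψ w x‖ₑ ^ (2 : ℝ) ≤ Cs * G := by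
      intro w hw
      rw [mem_closedBall, dist_zero_right] at hw
      calc ∫⁻ x, ‖T ψ w x‖ₑ ^ (2 : ℝ)
          ≤ ∫⁻ x, ‖∫ t, (1 - radialCutoff ε (2 * ε) t) * bogovskiiKV ψ w a k t * g (x - t)‖ₑ ^ (2 : ℝ) := by
            refine lintegral_mono fun x ↦ ?_
            simp only [hT]
            rw [enorm_mul]
            refine ENNReal.rpow_le_rpow ?_ (by norm_num)
            calc _ ≤ 1 * ‖∫ t, (1 - radialCutoff ε (2 * ε) t) * bogovskiiKV ψ w a k t * g (x - t)‖ₑ := by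
                  gcongr
                  rw [← ofReal_norm, Real.norm_eq_abs]
                  exact ENNReal.ofReal_le_one.2 (hζ1 x)
              _ = _ := one_mul _
        _ ≤ Cψ * G := hL ε hε w hw g hg hgc
        _ ≤ Cs * G := by gcongr
    calc ∫⁻ w in closedBall (0 : E3) (D + 1), ∫⁻ x, ‖T ψ w x‖ₑ ^ (2 : ℝ)
        ≤ ∫⁻ _ in closedBall (0 : E3) (D + 1), Cs * G := setLIntegral_mono measurable_const hin
      _ = Vol * Cs * G := by rw [setLIntegral_const]; ring
  have e0 : C₀ ≤ Cs := by simp only [hCs]; exact le_self_add.trans (le_self_add.trans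
    (le_self_add.trans (le_self_add.trans (le_self_add.trans (le_self_add.trans le_self_add)))))
  have et : Ct ≤ Cs := by
    simp only [hCs]
    calc Ct ≤ C₀ + Ct := le_add_self
      _ ≤ _ := le_self_add.trans (le_self_add.trans (le_self_add.trans (le_self_add.trans (le_self_add.trans le_self_add))))
  have ev : Cv ≤ Cs := by
    simp only [hCs]
    calc Cv ≤ C₀ + Ct + Cv := le_add_self
      _ ≤ _ := le_self_add.trans (le_self_add.trans (le_self_add.trans (le_self_add.trans le_self_add)))
  have eu : Cu ≤ Cs := by
    simp only [hCs]
    calc Cu ≤ C₀ + Ct + Cv + Cu := le_add_self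
      _ ≤ _ := le_self_add.trans (le_self_add.trans (le_self_add.trans le_self_add))
  have evt : Cvt ≤ Cs := by
    simp only [hCs]
    calc Cvt ≤ C₀ + Ct + Cv + Cu + Cvt := le_add_self
      _ ≤ _ := le_self_add.trans (le_self_add.trans le_self_add)
  have eut : Cut ≤ Cs := by
    simp only [hCs]
    calc Cut ≤ C₀ + Ct + Cv + Cu + Cvt + Cut := le_add_self
      _ ≤ _ := le_self_add.trans le_self_add
  have euv : Cuv ≤ Cs := by
    simp only [hCs]
    calc Cuv ≤ C₀ + Ct + Cv + Cu + Cvt + Cut + Cuv := le_add_self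
      _ ≤ _ := le_self_add
  have euvt : Cuvt ≤ Cs := by simp only [hCs]; exact le_add_self
  have T0 := hterm η C₀ e0 hL₀
  have Tt := hterm _ Ct et hLt
  have Tv := hterm _ Cv ev hLv
  have Tu := hterm _ Cu eu hLu
  have Tvt := hterm _ Cvt evt hLvt
  have Tut := hterm _ Cut eut hLut
  have Tuv := hterm _ Cuv euv hLuv
  have Tuvt := hterm _ Cuvt euvt hLuvt
  calc ∫⁻ x, ‖T η x x‖ₑ ^ (2 : ℝ) ≤ _ := hmain
    _ ≤ Cd * ((((Vol * Cs * G) + (Vol * Cs * G)) + ((Vol * Cs * G) + (Vol * Cs * G))) +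
        (((Vol * Cs * G) + (Vol * Cs * G)) + ((Vol * Cs * G) + (Vol * Cs * G)))) := by
        gcongr
    _ = Cd * (8 * (Vol * Cs)) * G := by ring

end Diag

end MaoOhTao

end Literature.Geometry.Lorentzian
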